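import Summits.BirchSwinnertonDyer.Rank1Residual.X5.TwoAdicTargetsTowerGap
import HarnessLib

/-!
# Route `ResidualThetaTransportAtTwo`, seed crux `SignedMuSeedAtTwoPlus` (stmt-BirchSwinnertonDyer-21438; =
# `stub_residualSeedAtTwo` of line `birth` of Kμ⁺ stmt-BirchSwinnertonDyer-20689): the algebraic stubs
# `S1 · stub_residualLayerRank` (line `layer-rank-certificate`) and `stub_rankZeroOfSlackStep` (line `fukuda-step`)
# ARE the tree's TOWER-GAP LEMMA — thin adapter, both registered shapes verbatim

Cell `bsd-wall`, width seat `bsd-wall-rtt-p4-w3` (g3). THEOREMS ONLY (no `def`, no named fact, no `sorry`); helper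
`--supports` the seed crux; nothing about any curve is asserted; BSD is not proved by this.

Both crux-ideate lines for the seed crux open with the same piece of commutative algebra over `Λ = ℤ_p⟦T⟧`: ONE slack
step between two residual layers, `#(X/(p,T^b)X) < p^{b−a} · #(X/(p,T^a)X)`, forces `X/pX` finite (hence `X` torsion
with `μ = 0`). This is ALREADY a kernel theorem of cell `b2b-bsdres` (class O1, lens-3 S-G4.0b):
`Summit.BirchSwinnertonDyer.Rank1Residual.X5.TowerGap.finite_modP_of_card_quotient_lt` (proof without the structure
theorem: a proper step of `T^m N ⊇ ⋯ ⊇ T^{m+k}N` in a group killed by `p` has index divisible by `p`; an improper step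
is killed by Nakayama), stated with `towerIdeal p m = (p) + (T)^m` and `modPSubmodule p X = (p) • X`. This file only
TRANSLATES: `towerIdeal p m = Ideal.span {C p, T^m}` (`towerIdeal_eq_span_pair`) and `modPSubmodule p X = augIdealP p • ⊤`
(by `rfl`), giving

* `finite_quotient_augIdealP_of_card_layer_lt` — layers `a ≤ b`, spans and `augIdealP` (the currency of
  `Kobayashi2003.SignedSelmerDualData` consumers: `isTorsion_and_mu_eq_zero_iff_finite_quotient`,
  `moduleFinite_padicInt_of_finite_quotient_augIdealP`);
* `residualLayerRank` — the statement `ResidualLayerRank` of `Cruxes/SignedMuSeedAtTwoPlus/Lines/layer_rank_certificate.lean`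
  UNFOLDED VERBATIM (`layerIdeal p q = Ideal.span {C p, T^q}`; every prime `p`, `q ≥ 1`, `a = 1`, `b = q`);
* `rankZeroOfSlackStep` — the statement `RankZeroOfSlackStep` of `Cruxes/SignedMuSeedAtTwoPlus/Lines/fukuda_step.lean`
  VERBATIM (`p = 2`, `m > 0`, `a = m`, `b = 2m`).

So whichever of the two lines crux-triage passes, its first stub closes by `exact` from here (the skeletons' local
`def`s are transparent abbreviations of these spans). References: [Fukuda1994] T. Fukuda, Proc. Japan Acad. 70 (1994)
Thm. 1; [Washington1997] §13.3, Lemma 13.16; [NeukirchSchmidtWingberg2008] (5.1.4) Remark 4, (5.3.10).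
-/

set_option autoImplicit false
set_option linter.dupNamespace false

noncomputable section

open Literature.NumberTheory.EllipticCurves Literature.NumberTheory.EllipticCurves.IwasawaAlgebra
  Summit.BirchSwinnertonDyer.Rank1Residual.X5.TowerGap

namespace Summit.BirchSwinnertonDyer.BirchSwinnertonDyer.Theorems.SignedMuAtTwo.LayerRank

/-- **The residual layer-rank criterion in span / `augIdealP` currency.** For a finitely generated `Λ = ℤ_p⟦T⟧`-module
`X` and layers `a ≤ b`: `#(X/(p,T^b)X) < p^{b−a} · #(X/(p,T^a)X)` ⟹ `X/pX` is finite. The tree's tower-gap lemma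
`TowerGap.finite_modP_of_card_quotient_lt` (cell b2b, class O1) with `towerIdeal p m = Ideal.span {C p, T^m}`
(`towerIdeal_eq_span_pair`) and `modPSubmodule p X = augIdealP p • ⊤` (definitional). [cite: Fukuda1994, Thm. 1]
[cite: Washington1997, §13.3, Lemma 13.16] -/
theorem finite_quotient_augIdealP_of_card_layer_lt (p : ℕ) [Fact p.Prime] (X : Type*) [AddCommGroup X]
    [Module (IwasawaAlgebra p) X] [Module.Finite (IwasawaAlgebra p) X] {a b : ℕ} (hab : a ≤ b)
    (h : Nat.card (X ⧸ (Ideal.span {(PowerSeries.C (p : ℤ_[p]) : IwasawaAlgebra p), PowerSeries.X ^ b} •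
        (⊤ : Submodule (IwasawaAlgebra p) X))) <
      p ^ (b - a) * Nat.card (X ⧸ (Ideal.span {(PowerSeries.C (p : ℤ_[p]) : IwasawaAlgebra p),
        PowerSeries.X ^ a} • (⊤ : Submodule (IwasawaAlgebra p) X)))) :
    Finite (X ⧸ (augIdealP p • (⊤ : Submodule (IwasawaAlgebra p) X))) := by
  have h' : Nat.card (X ⧸ (towerIdeal p (a + (b - a)) • (⊤ : Submodule (IwasawaAlgebra p) X))) <
      p ^ (b - a) * Nat.card (X ⧸ (towerIdeal p a • (⊤ : Submodule (IwasawaAlgebra p) X))) := by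
    rw [show a + (b - a) = b by omega, towerIdeal_eq_span_pair, towerIdeal_eq_span_pair]
    exact h
  exact finite_modP_of_card_quotient_lt p a (b - a) h'

/-- **`S1 · stub_residualLayerRank` of line `layer-rank-certificate` (seed crux `SignedMuSeedAtTwoPlus`,
stmt-BirchSwinnertonDyer-21438) — its statement `ResidualLayerRank` unfolded VERBATIM** (`layerIdeal p q =
Ideal.span {C p, T^q}`): for every prime `p`, every finitely generated `Λ`-module `X` and `q ≥ 1`,
`#(X/(p,T^q)X) < p^{q−1} · #(X/(p,T)X)` ⟹ `X/pX` finite. [cite: Fukuda1994, Thm. 1] [cite: Washington1997, §13.3] -/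
theorem residualLayerRank :
    ∀ (p : ℕ) [Fact p.Prime] (X : Type) [AddCommGroup X] [Module (IwasawaAlgebra p) X]
      [Module.Finite (IwasawaAlgebra p) X] (q : ℕ), 1 ≤ q →
      Nat.card (X ⧸ (Ideal.span {PowerSeries.C (p : ℤ_[p]), (PowerSeries.X : IwasawaAlgebra p) ^ q} •
          (⊤ : Submodule (IwasawaAlgebra p) X))) <
        p ^ (q - 1) * Nat.card (X ⧸ (Ideal.span {PowerSeries.C (p : ℤ_[p]), (PowerSeries.X : IwasawaAlgebra p) ^ 1} •
          (⊤ : Submodule (IwasawaAlgebra p) X))) →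
      Finite (X ⧸ (augIdealP p • (⊤ : Submodule (IwasawaAlgebra p) X))) :=
  fun p _ X _ _ _ _q hq h ↦ finite_quotient_augIdealP_of_card_layer_lt p X hq h

/-- **Stub 1 `stub_rankZeroOfSlackStep` of line `fukuda-step` (seed crux `SignedMuSeedAtTwoPlus`,
stmt-BirchSwinnertonDyer-21438) — its statement `RankZeroOfSlackStep` VERBATIM**: for a finitely generated
`ℤ₂⟦T⟧`-module `X` and `m > 0`, `#(X/(2,T^{2m})X) < 2^m · #(X/(2,T^m)X)` ⟹ `X/2X` finite (`a = m`, `b = 2m`).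
[cite: Fukuda1994, Thm. 1] [cite: Washington1997, §13.3] -/
theorem rankZeroOfSlackStep :
    ∀ (X : Type) [AddCommGroup X] [Module (IwasawaAlgebra 2) X] [Module.Finite (IwasawaAlgebra 2) X] (m : ℕ),
      0 < m →
      Nat.card (X ⧸ (Ideal.span {PowerSeries.C (2 : ℤ_[2]), (PowerSeries.X : IwasawaAlgebra 2) ^ (2 * m)} •
          (⊤ : Submodule (IwasawaAlgebra 2) X))) <
        2 ^ m * Nat.card (X ⧸ (Ideal.span {PowerSeries.C (2 : ℤ_[2]), (PowerSeries.X : IwasawaAlgebra 2) ^ m} •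
          (⊤ : Submodule (IwasawaAlgebra 2) X))) →
      Finite (X ⧸ (IwasawaAlgebra.augIdealP 2 • (⊤ : Submodule (IwasawaAlgebra 2) X))) := by
  intro X _ _ _ m _hm h
  have hab : m ≤ 2 * m := by omega
  have h2 : ((2 : ℕ) : ℤ_[2]) = (2 : ℤ_[2]) := by norm_num
  have h' : Nat.card (X ⧸ (Ideal.span {(PowerSeries.C ((2 : ℕ) : ℤ_[2]) : IwasawaAlgebra 2),
        PowerSeries.X ^ (2 * m)} • (⊤ : Submodule (IwasawaAlgebra 2) X))) <
      2 ^ (2 * m - m) * Nat.card (X ⧸ (Ideal.span {(PowerSeries.C ((2 : ℕ) : ℤ_[2]) : IwasawaAlgebra 2),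
        PowerSeries.X ^ m} • (⊤ : Submodule (IwasawaAlgebra 2) X))) := by
    rw [h2, show 2 * m - m = m by omega]
    exact h
  exact finite_quotient_augIdealP_of_card_layer_lt 2 X hab h'

end Summit.BirchSwinnertonDyer.BirchSwinnertonDyer.Theorems.SignedMuAtTwo.LayerRank

end
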